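import Summits.QuantumFields.YangMills.Theorems.F4SubCurvatureDoorFibreDichotomyPolyIsometry
import Summits.QuantumFields.YangMills.Theorems.F4SubCurvatureDoorFibreDichotomyHarmonicGap
import Mathlib
import HarnessLib

/-!
# LINE g21-B «fibre dichotomy» (⟨stmt-QuantumFields-23125⟩) — B4 helper: the harmonic moments of degrees `1 … 5` of a
# `D₄`-invariant kernel vanish (stub plan step H6)

Helper toward the registered stub B4 `stub_singleShellDichotomy` (stub plan `Lines/fibre_dichotomy_stubplans.md`, H6).  Let `u : ℝ⁴ → ℝ` be
continuous off the origin and invariant under every `D₄`-isometry (as the patched kernel of the rung R-B4e `MirrorPatching` is), and let `Y`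
be harmonic homogeneous of degree `1 ≤ L ≤ 5`.  Then `∫_{S³} Y(α) u(rα) dσ = 0` for every `r > 0`.

No Reynolds operator and no invariance of the surface measure are used.  Instead (`functional_eq_zero_of_invariant`): on the
finite-dimensional space `W` of harmonic homogeneous polynomials of degree `L`, the shell functional `Λ(Y) = ∫_{a<‖x‖<b} u·Y dx` and the
positive form `B(Y, Y') = ∫_{‖x‖<1} Y Y' dx` are both invariant under `Y ↦ Y ∘ R` for every `D₄`-isometry `R` (Lebesgue measure and the
sets are `R`-invariant, `u ∘ R = u`); the Riesz vector of `Λ` w.r.t. `B` is then fixed by every such `R`, hence `0` by the landed rung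
R-B4b `InvariantHarmonicGap` (✓ `invariantHarmonicGap_holds`), so `Λ = 0`; the sphere moment is recovered from the shell integrals by polar
coordinates and continuity (`sphere_moment_eq_zero_of_shell_integrals`).

Mathlib + tree only; no `sorry`; no new definitions.  HONEST LABEL: helper for a registered stub of an OPEN line; B4, B5, S1, S2, ⟨23125⟩,
⟨23035⟩, R2d and the Yang–Mills mass gap remain OPEN; no summit is proved by a line.
-/

noncomputable section

open MeasureTheory MeasureTheory.Measure Set Function Filter Topology Metric Module InnerProductSpace
open scoped RealInnerProductSpace BigOperators

namespace Summit.QuantumFields.YangMills.Theorems.F4SubCurvatureDoorHarmonicMomentODE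

open MvPolynomial (aeval X)
open Literature.Analysis.Calculus.MvPoly (toFun lap lap_add lap_smul contDiff_toFun toFun_smul_of_isHomogeneous toFun_mul toFun_add
  toFun_smul)
open Summit.QuantumFields.YangMills.Theorems.F4SubCurvatureDoorLaplaceFourierRegistered (E4)
open Summit.QuantumFields.YangMills.Theorems.F4SubCurvatureDoorFibreDichotomyAxis (IsD4Isometry invariantHarmonicGap_holds)

/-! ## Invariant functionals on a finite-dimensional space with an invariant positive form -/

/-- **Invariant functionals vanish when there are no fixed vectors.**  Let `V` be finite-dimensional over `ℝ` with a symmetric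
positive-definite bilinear form `B`, `S` a family of `B`-isometries without common non-zero fixed vector, and `Λ` an `S`-invariant linear
functional.  Then `Λ = 0`: the `B`-Riesz vector `v` of `Λ` satisfies `B(Tv − v, Tv − v) = 0` for `T ∈ S`. -/
theorem functional_eq_zero_of_invariant {V : Type*} [AddCommGroup V] [Module ℝ V] [FiniteDimensional ℝ V]
    (B : V →ₗ[ℝ] V →ₗ[ℝ] ℝ) (hsymm : ∀ u v, B u v = B v u) (hpos : ∀ v, v ≠ 0 → 0 < B v v)
    (S : Set (V →ₗ[ℝ] V)) (hBS : ∀ T ∈ S, ∀ u v, B (T u) (T v) = B u v) (hfix : ∀ v, (∀ T ∈ S, T v = v) → v = 0)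
    (Λ : V →ₗ[ℝ] ℝ) (hΛ : ∀ T ∈ S, ∀ v, Λ (T v) = Λ v) : Λ = 0 := by
  -- `B : V → V*` is injective, hence surjective
  have hinj : Function.Injective B := by
    intro u v huv
    by_contra hne
    have h0 : B (u - v) = 0 := by rw [map_sub, huv, sub_self]
    have h1 : B (u - v) (u - v) = 0 := by rw [h0, LinearMap.zero_apply]
    have h2 := hpos (u - v) (sub_ne_zero.2 hne)
    rw [h1] at h2
    exact lt_irrefl _ h2
  have hsurj : Function.Surjective B :=
    (LinearMap.injective_iff_surjective_of_finrank_eq_finrank (Subspace.dual_finrank_eq).symm).1 hinj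
  obtain ⟨v, hv⟩ := hsurj Λ
  -- the Riesz vector is fixed by `S`
  have hfixed : ∀ T ∈ S, T v = v := by
    intro T hT
    have e1 : B (T v) (T v) = B v v := hBS T hT v v
    have e2 : B v (T v) = B v v := by rw [hv]; exact hΛ T hT v
    have e3 : B (T v) v = B v v := by rw [hsymm]; exact e2
    have hq : B (T v - v) (T v - v) = 0 := by
      simp only [map_sub, LinearMap.sub_apply, e1, e2, e3]
      ring
    by_contra hne
    have := hpos _ (sub_ne_zero.2 hne)
    rw [hq] at this
    exact lt_irrefl _ this
  rw [← hv, hfix v hfixed, map_zero]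

/-! ## From shell integrals to sphere moments -/

/-- A function continuous off the origin is integrable on every shell `{a < ‖x‖ < b}` with `a > 0`. -/
theorem integrableOn_shell {g : E4 → ℝ} (hg : ContinuousOn g {0}ᶜ) {a b : ℝ} (ha : 0 < a) :
    IntegrableOn g {x : E4 | a < ‖x‖ ∧ ‖x‖ < b} volume := by
  have hK : IsCompact {x : E4 | a ≤ ‖x‖ ∧ ‖x‖ ≤ b} := by
    have : {x : E4 | a ≤ ‖x‖ ∧ ‖x‖ ≤ b} ⊆ closedBall 0 b := fun x hx => by
      rw [mem_closedBall, dist_zero_right]; exact hx.2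
    exact (isCompact_closedBall 0 b).of_isClosed_subset
      ((isClosed_le continuous_const continuous_norm).inter (isClosed_le continuous_norm continuous_const)) this
  have hK0 : {x : E4 | a ≤ ‖x‖ ∧ ‖x‖ ≤ b} ⊆ {0}ᶜ := fun x hx h0 => by
    rw [mem_singleton_iff] at h0
    have h1 : a ≤ ‖x‖ := hx.1
    rw [h0, norm_zero] at h1
    linarith
  exact ((hg.mono hK0).integrableOn_compact hK).mono_set fun x hx => ⟨hx.1.le, hx.2.le⟩

/-- **Vanishing shell integrals force vanishing sphere moments.**  If `u` is continuous off the origin, `Y` homogeneous of degree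
`L`, and `∫_{a<‖x‖<b} u · Y dx = 0` for all `0 < a < b`, then `∫_{S³} Y(α) u(rα) dσ = 0` for every `r > 0` (polar coordinates and
continuity in the radius). -/
theorem sphere_moment_eq_zero_of_shell_integrals {u : E4 → ℝ} (hu : ContinuousOn u {0}ᶜ) {P : MvPolynomial (Fin 4) ℝ} {L : ℕ}
    (hP : P.IsHomogeneous L)
    (h : ∀ a b : ℝ, 0 < a → a < b → ∫ x in {x : E4 | a < ‖x‖ ∧ ‖x‖ < b}, u x * toFun P x = 0) {r : ℝ} (hr : 0 < r) :
    ∫ α, toFun P (α : E4) * u (r • (α : E4)) ∂(volume : Measure E4).toSphere = 0 := by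
  set g : E4 → ℝ := fun x => u x * toFun P x with hg_def
  have hg : ContinuousOn g {0}ᶜ := hu.mul (contDiff_toFun (m := 0) P).continuous.continuousOn
  set F : ℝ → ℝ := Literature.Analysis.FluidPDE.sphereIntegral (volume : Measure E4) g with hF_def
  have hFc : ContinuousOn F (Ioi 0) := Literature.Analysis.FluidPDE.continuousOn_sphereIntegral_Ioi (volume : Measure E4) hg
  -- shell integrals in polar coordinates
  have hshell : ∀ a b : ℝ, 0 < a → a < b → ∫ ρ in Ioo a b, ρ ^ 3 * F ρ = 0 := by
    intro a b ha hab
    have hpol := Literature.Analysis.FluidPDE.setIntegral_shell_eq_integral_sphereIntegral (volume : Measure E4)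
      (integrableOn_shell hg ha (b := b)) ha.le
    rw [h a b ha hab, finrank_euclideanSpace_fin] at hpol
    simpa [smul_eq_mul] using hpol.symm
  -- the continuous function `H ρ = ρ³ F ρ` with vanishing integrals over all subintervals of `(0, ∞)` vanishes at `r`
  set H : ℝ → ℝ := fun ρ => ρ ^ 3 * F ρ with hH_def
  have hHc : ContinuousOn H (Ioi 0) := (continuous_pow 3).continuousOn.mul hFc
  have hHr : H r = 0 := by
    by_contra hne
    set c : ℝ := H r with hc
    have hc2 : 0 < c * c := mul_self_pos.2 hne
    have hH2c : ContinuousOn (fun ρ => c * H ρ) (Ioi 0) := continuousOn_const.mul hHc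
    have hat : ContinuousAt (fun ρ => c * H ρ) r := hH2c.continuousAt (Ioi_mem_nhds hr)
    have hev : ∀ᶠ ρ in 𝓝 r, c * c / 2 < c * H ρ := hat.eventually_const_lt (by show c * c / 2 < c * H r; rw [← hc]; linarith)
    obtain ⟨ε, hε, hball⟩ := Metric.eventually_nhds_iff.1 hev
    set δ : ℝ := min (ε / 2) (r / 2) with hδ
    have hδpos : 0 < δ := by positivity
    have hδε : δ < ε := lt_of_le_of_lt (min_le_left _ _) (by linarith)
    have hδr : δ < r := lt_of_le_of_lt (min_le_right _ _) (by linarith)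
    have hsub : Icc (r - δ) (r + δ) ⊆ Ioi 0 := fun ρ hρ => by
      simp only [mem_Ioi]; linarith [hρ.1]
    have hposI : ∀ ρ ∈ Ioo (r - δ) (r + δ), 0 < c * H ρ := by
      intro ρ hρ
      have hd : dist ρ r < ε := by
        rw [Real.dist_eq, abs_lt]; constructor <;> linarith [hρ.1, hρ.2]
      have := hball hd
      linarith
    have hint : IntervalIntegrable (fun ρ => c * H ρ) volume (r - δ) (r + δ) :=
      (hH2c.mono (by rw [uIcc_of_le (by linarith)]; exact hsub)).intervalIntegrable
    have hpos := intervalIntegral.intervalIntegral_pos_of_pos_on hint hposI (by linarith)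
    have hzero : ∫ ρ in (r - δ)..(r + δ), c * H ρ = 0 := by
      rw [intervalIntegral.integral_of_le (by linarith), integral_Ioc_eq_integral_Ioo, integral_const_mul,
        hshell (r - δ) (r + δ) (by linarith) (by linarith), mul_zero]
    rw [hzero] at hpos
    exact lt_irrefl _ hpos
  -- unfold: `F r = r^L · (the moment)`
  have hFr : F r = 0 := by
    have h3 : r ^ 3 ≠ 0 := pow_ne_zero _ hr.ne'
    have := hHr
    simp only [hH_def] at this
    exact (mul_eq_zero.1 this).resolve_left h3
  have hmom : F r = r ^ L * ∫ α, toFun P (α : E4) * u (r • (α : E4)) ∂(volume : Measure E4).toSphere := by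
    rw [hF_def, Literature.Analysis.FluidPDE.sphereIntegral_def, ← integral_const_mul]
    refine integral_congr_ae (ae_of_all _ fun α => ?_)
    simp only [hg_def, toFun_smul_of_isHomogeneous hP r]
    ring
  rw [hmom] at hFr
  exact (mul_eq_zero.1 hFr).resolve_left (pow_ne_zero _ hr.ne')

/-! ## The harmonic moments of degrees `1 … 5` of an invariant kernel vanish -/

/-- **Stub plan H6: harmonic moments of low degree of a `D₄`-invariant kernel vanish.**  Let `u : ℝ⁴ → ℝ` be continuous off the origin
with `u ∘ R = u` for every `D₄`-isometry `R`, and `Y` harmonic homogeneous of degree `1 ≤ L ≤ 5`.  Then `∫_{S³} Y(α) u(rα) dσ = 0` for all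
`r > 0` (invariant functional / invariant positive form / no fixed vectors by R-B4b `InvariantHarmonicGap`). -/
theorem harmonicMoment_eq_zero_of_invariant {u : E4 → ℝ} (hu : ContinuousOn u {0}ᶜ)
    (hinv : ∀ R : E4 ≃ₗᵢ[ℝ] E4, IsD4Isometry R → ∀ x : E4, u (R x) = u x)
    {L : ℕ} (hL1 : 1 ≤ L) (hL5 : L ≤ 5) {P : MvPolynomial (Fin 4) ℝ} (hP : P.IsHomogeneous L) (hharm : lap P = 0)
    {r : ℝ} (hr : 0 < r) :
    ∫ α, toFun P (α : E4) * u (r • (α : E4)) ∂(volume : Measure E4).toSphere = 0 := by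
  refine sphere_moment_eq_zero_of_shell_integrals hu hP (fun a b ha hab => ?_) hr
  -- the space `W` of harmonic homogeneous polynomials of degree `L`
  let lapL : MvPolynomial (Fin 4) ℝ →ₗ[ℝ] MvPolynomial (Fin 4) ℝ :=
    { toFun := lap, map_add' := lap_add, map_smul' := fun c Q => by rw [lap_smul]; rfl }
  let W : Submodule ℝ (MvPolynomial (Fin 4) ℝ) := MvPolynomial.homogeneousSubmodule (Fin 4) ℝ L ⊓ LinearMap.ker lapL
  have memW : ∀ Q : MvPolynomial (Fin 4) ℝ, Q ∈ W ↔ Q.IsHomogeneous L ∧ lap Q = 0 := fun Q => by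
    simp only [W, Submodule.mem_inf, MvPolynomial.mem_homogeneousSubmodule, LinearMap.mem_ker]
    rfl
  haveI : FiniteDimensional ℝ W := by
    have hle : W ≤ MvPolynomial.restrictTotalDegree (Fin 4) ℝ L := fun Q hQ => by
      rw [MvPolynomial.mem_restrictTotalDegree]
      exact ((memW Q).1 hQ).1.totalDegree_le
    exact Submodule.finiteDimensional_of_le hle
  -- the substitutions `Y ↦ Y ∘ R`
  let lin : (E4 ≃ₗᵢ[ℝ] E4) → Fin 4 → MvPolynomial (Fin 4) ℝ := fun R i =>
    ∑ j : Fin 4, (R (EuclideanSpace.single j (1 : ℝ))) i • (X j : MvPolynomial (Fin 4) ℝ)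
  have subW : ∀ R : E4 ≃ₗᵢ[ℝ] E4, ∀ Q ∈ W, (aeval (lin R)).toLinearMap Q ∈ W := by
    intro R Q hQ
    obtain ⟨h1, h2⟩ := (memW Q).1 hQ
    exact (memW _).2 ⟨isHomogeneous_aevalIso R h1, lap_aevalIso_eq_zero R h2⟩
  let ρ : (E4 ≃ₗᵢ[ℝ] E4) → (W →ₗ[ℝ] W) := fun R => ((aeval (lin R)).toLinearMap).restrict (subW R)
  have ρ_coe : ∀ (R : E4 ≃ₗᵢ[ℝ] E4) (q : W), ((ρ R q : W) : MvPolynomial (Fin 4) ℝ) = aeval (lin R) (q : MvPolynomial (Fin 4) ℝ) :=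
    fun R q => rfl
  have ρ_toFun : ∀ (R : E4 ≃ₗᵢ[ℝ] E4) (q : W) (x : E4),
      toFun ((ρ R q : W) : MvPolynomial (Fin 4) ℝ) x = toFun (q : MvPolynomial (Fin 4) ℝ) (R x) := fun R q x => by
    rw [ρ_coe]
    exact toFun_aevalIso R _ x
  let S : Set (W →ₗ[ℝ] W) := {T | ∃ R : E4 ≃ₗᵢ[ℝ] E4, IsD4Isometry R ∧ T = ρ R}
  -- the invariant positive form `B(p, q) = ∫_{ball} p q`
  have hIb : ∀ p q : W, IntegrableOn (fun x : E4 => toFun (p : MvPolynomial (Fin 4) ℝ) x * toFun (q : MvPolynomial (Fin 4) ℝ) x)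
      (ball (0 : E4) 1) volume := fun p q => integrableOn_toFun_mul_ball _ _
  let B : W →ₗ[ℝ] W →ₗ[ℝ] ℝ := LinearMap.mk₂ ℝ
    (fun p q : W => ∫ x in ball (0 : E4) 1, toFun (p : MvPolynomial (Fin 4) ℝ) x * toFun (q : MvPolynomial (Fin 4) ℝ) x)
    (fun p₁ p₂ q => by
      simp only [Submodule.coe_add, toFun_add, add_mul]
      exact integral_add (hIb p₁ q) (hIb p₂ q))
    (fun c p q => by
      simp only [Submodule.coe_smul, toFun_smul, mul_assoc, smul_eq_mul]
      exact integral_const_mul c _)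
    (fun p q₁ q₂ => by
      simp only [Submodule.coe_add, toFun_add, mul_add]
      exact integral_add (hIb p q₁) (hIb p q₂))
    (fun c p q => by
      simp only [Submodule.coe_smul, toFun_smul, smul_eq_mul, mul_left_comm _ c]
      exact integral_const_mul c _)
  have B_apply : ∀ p q : W, B p q =
      ∫ x in ball (0 : E4) 1, toFun (p : MvPolynomial (Fin 4) ℝ) x * toFun (q : MvPolynomial (Fin 4) ℝ) x := fun p q => rfl
  -- the invariant functional `Λ(q) = ∫_{shell} u q`
  have hIs : ∀ q : W, IntegrableOn (fun x : E4 => u x * toFun (q : MvPolynomial (Fin 4) ℝ) x) {x : E4 | a < ‖x‖ ∧ ‖x‖ < b} volume :=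
    fun q => integrableOn_shell (hu.mul (contDiff_toFun (m := 0) _).continuous.continuousOn) ha
  let Λ : W →ₗ[ℝ] ℝ :=
    { toFun := fun q => ∫ x in {x : E4 | a < ‖x‖ ∧ ‖x‖ < b}, u x * toFun (q : MvPolynomial (Fin 4) ℝ) x
      map_add' := fun q₁ q₂ => by
        simp only [Submodule.coe_add, toFun_add, mul_add]
        exact integral_add (hIs q₁) (hIs q₂)
      map_smul' := fun c q => by
        simp only [Submodule.coe_smul, toFun_smul, RingHom.id_apply, smul_eq_mul, mul_left_comm _ c]
        exact integral_const_mul c _ }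
  have Λ_apply : ∀ q : W, Λ q = ∫ x in {x : E4 | a < ‖x‖ ∧ ‖x‖ < b}, u x * toFun (q : MvPolynomial (Fin 4) ℝ) x := fun q => rfl
  -- hypotheses of the abstract lemma
  have hsymm : ∀ p q : W, B p q = B q p := fun p q => by
    rw [B_apply, B_apply]
    exact integral_congr_ae (ae_of_all _ fun x => mul_comm _ _)
  have hposB : ∀ v : W, v ≠ 0 → 0 < B v v := fun v hv => by
    rw [B_apply]
    have hv' : (v : MvPolynomial (Fin 4) ℝ) ≠ 0 := fun h0 => hv (Subtype.ext h0)
    exact integral_ball_sq_pos ((memW _).1 v.2).1 hv'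
  have hBS : ∀ T ∈ S, ∀ p q : W, B (T p) (T q) = B p q := by
    rintro T ⟨R, -, rfl⟩ p q
    rw [B_apply, B_apply]
    simp_rw [ρ_toFun]
    exact setIntegral_comp_iso_of_preimage_eq R
      (fun y => toFun (p : MvPolynomial (Fin 4) ℝ) y * toFun (q : MvPolynomial (Fin 4) ℝ) y) (iso_preimage_ball R 1)
  have hfix : ∀ v : W, (∀ T ∈ S, T v = v) → v = 0 := by
    intro v hv
    have hv1 : (v : MvPolynomial (Fin 4) ℝ) = 0 := by
      obtain ⟨hhom, hlap⟩ := (memW _).1 v.2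
      refine invariantHarmonicGap_holds L (v : MvPolynomial (Fin 4) ℝ) hL1 hL5 hhom ?_ ?_
      · show Summit.QuantumFields.YangMills.Theorems.F4SubCurvatureDoorFischerNormalForm.laplacian (v : MvPolynomial (Fin 4) ℝ) = 0
        exact hlap
      · intro R hR x
        have h1 := hv (ρ R) ⟨R, hR, rfl⟩
        have h2 : toFun ((ρ R v : W) : MvPolynomial (Fin 4) ℝ) x = toFun (v : MvPolynomial (Fin 4) ℝ) x := by rw [h1]
        rw [ρ_toFun] at h2
        exact h2
    exact Subtype.ext hv1
  have hΛ : ∀ T ∈ S, ∀ q : W, Λ (T q) = Λ q := by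
    rintro T ⟨R, hR, rfl⟩ q
    rw [Λ_apply, Λ_apply]
    simp_rw [ρ_toFun]
    have e : ∀ x : E4, u x * toFun (q : MvPolynomial (Fin 4) ℝ) (R x) =
        (fun y => u y * toFun (q : MvPolynomial (Fin 4) ℝ) y) (R x) := fun x => by simp only [hinv R hR x]
    simp_rw [e]
    exact setIntegral_comp_iso_of_preimage_eq R (fun y => u y * toFun (q : MvPolynomial (Fin 4) ℝ) y) (iso_preimage_shell R a b)
  -- conclude
  have hmain := functional_eq_zero_of_invariant B hsymm hposB S hBS hfix Λ hΛ
  have h0 := LinearMap.congr_fun hmain ⟨P, (memW P).2 ⟨hP, hharm⟩⟩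
  rw [Λ_apply, LinearMap.zero_apply] at h0
  exact h0

end Summit.QuantumFields.YangMills.Theorems.F4SubCurvatureDoorHarmonicMomentODE

end
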